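import Summits.HodgeConjecture.CorCM.Census.CoinvariantComplementLaw
import Summits.HodgeConjecture.CorCM.FaceCoinvariantFloor
import HarnessLib

/-!
# The face-coinvariant floor when complex conjugation is complemented: `φ₂(F) = β(F) − 1 − δ(F)`

COR-CM (cell `pub-hodgecm2`), count-neutral kernel combinatorics by the binder seat b09 (gen 31; lane DIRECT-FACTOR): the intrinsic
form, for a Galois CM field `F`, of `Census/CoinvariantComplementLaw.lean` (XIII); sequel of `CorCM/FaceCoinvariantFloor.lean`,
`CorCM/FaceCoinvariantSplit.lean`, `CorCM/FaceCoinvariantOddHalf.lean`.  Theorems only; no `decide`, no certificate, no named fact, no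
`sorry`.  HONEST FRAMING: `HC_CM` is NOT proved; nothing here is a period.  T5: n/a-class (no named-fact / conjecture-def binder; the
complement hypothesis is one `Subgroup (GalT F)` and one plain binder).

THE STATEMENT (`fibreTwo_add_one_add_wdelta_eq_card_block_of_cpl`).  If complex conjugation `conjT` has a COMPLEMENT among the
Galois translates of `F` — a subgroup `A ≤ GalT F` with `P ∈ A ↔ conjT·P ∉ A`, equivalently (`…_of_index_two`) a subgroup of index two
missing `conjT`; DICTIONARY (cited, not formalised): `Gal(F/ℚ) = Gal(F/K) × ⟨conj⟩` for an imaginary quadratic subfield `K ⊂ F`,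
`F = F⁺K` — the unitary ∕ Picard-modular situation `F ⊇ E` of COR-CM — then **`φ₂(F) + 1 + δ(F) = β(F)`**: the coinvariant floor of a
face-period route (`FaceCoinvariantFloor.fibreTwo_le_card_of_hgen`: `|𝒮| ≥ φ₂(F)`) is EXACTLY the parity floor `β(F) − 1 − δ(F)` of
`FaceParityFloor`, and no half-parity excess (`FaceHalfParityFloor`, André-3ʼs `t`) occurs.  By parity of `n = [F:ℚ]/2 = [F⁺:ℚ]`:
`n` even ⇒ `δ(F) = 1` and **`φ₂(F) + 2 = β(F)`** (`fibreTwo_add_two_eq_card_block_of_cpl`; e.g. `Gal ≅ S₃ × C₂`: `β = 10, φ₂ = 8`;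
`D₄ × C₂`: `27, 25`; `Q₈ × C₂`: `21, 19`; `C₂⁴`: `30, 28`); `n` odd is `FaceCoinvariantOddHalf` (`φ₂(F) + 1 = β(F)`).

## References
* [Pohlmann1968] H. Pohlmann, Algebraic cycles on abelian varieties of complex multiplication type, Ann. of Math. 88 (1968), Thm 1.
* [Milne1999] J. S. Milne, Lefschetz motives and the Tate conjecture, Compositio Math. 117 (1999), Prop. 2.1, p. 54.
-/

noncomputable section

open NumberField NumberField.ComplexEmbedding

namespace Summit.HodgeConjecture.CorCM.FaceCoinvariant

open Literature.AlgebraicGeometry.Motives (CMType)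
open Summit.HodgeConjecture.CorCM.Prior.AllgGroup.RfwfAllgGroup
open Summit.HodgeConjecture.CorCM.Census.BlockParity
open Summit.HodgeConjecture.CorCM.Census.Coinvariant

variable {F : Type} [Field F] [NumberField F]

/-- **A subgroup of index two of the Galois translates missing `conjT` is a complement of `conjT`.** [folklore] -/
theorem cpl_of_index_two [IsTotallyComplex F] {A : Subgroup (GalT F)} (h2 : A.index = 2) (hc : conjT ∉ A) (P : GalT F) :
    P ∈ A ↔ conjT * P ∉ A :=
  Census.Coinvariant.cpl_of_index_two conjT h2 hc P

/-- **COMPLEMENTED CONJUGATION: `φ₂(F) + 1 + δ(F) = β(F)`** — the coinvariant floor of `F` is the parity floor (`δ(F)` read at any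
base type). [folklore] -/
theorem fibreTwo_add_one_add_wdelta_eq_card_block_of_cpl [IsCMField F] [IsGalois ℚ F] {A : Subgroup (GalT F)}
    (hA : ∀ P : GalT F, P ∈ A ↔ conjT * P ∉ A) (T₀ : CMF (GalT F) conjT) :
    fibreTwo (conjT : GalT F) conjT_mul_self + 1 + wdelta (conjT : GalT F) T₀ = Fintype.card (Block (conjT : GalT F)) :=
  Census.Coinvariant.fibreTwo_add_one_add_wdelta_eq_card_block_of_cpl conjT conjT_mul_self conjT_ne_one
    (fun P => FaceBasis.conjT_comm P) hA T₀

/-- **The two floors coincide when `conjT` is complemented**: `φ₂(F) = dim_𝔽₂ span par(faces)`. [folklore] -/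
theorem fibreTwo_eq_finrank_span_par_of_cpl [IsCMField F] [IsGalois ℚ F] {A : Subgroup (GalT F)}
    (hA : ∀ P : GalT F, P ∈ A ↔ conjT * P ∉ A) :
    fibreTwo (conjT : GalT F) conjT_mul_self =
      Module.finrank (ZMod 2) ↥(Submodule.span (ZMod 2) (par (conjT : GalT F) '' gfaceSet (GalT F) conjT conjT_mul_self)) :=
  Census.Coinvariant.fibreTwo_eq_finrank_span_par_of_cpl conjT conjT_mul_self conjT_ne_one (fun P => FaceBasis.conjT_comm P) hA

/-- **`n = [F:ℚ]/2` even and `conjT` complemented ⇒ `δ(F) = 1`** (every Galois translate has `Pⁿ = 1`). [folklore] -/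
theorem wdelta_eq_one_of_cpl [IsCMField F] [IsGalois ℚ F] {A : Subgroup (GalT F)}
    (hA : ∀ P : GalT F, P ∈ A ↔ conjT * P ∉ A) (heven : Even (Module.finrank ℚ F / 2)) (T₀ : CMF (GalT F) conjT) :
    wdelta (conjT : GalT F) T₀ = 1 :=
  Census.Coinvariant.wdelta_eq_one_of_cpl conjT conjT_mul_self conjT_ne_one (fun P => FaceBasis.conjT_comm P) hA
    (by rw [FaceCensus.card_galT]; exact heven) T₀

/-- **`n` even, `conjT` complemented: `φ₂(F) + 2 = β(F)`** (`Gal(F/ℚ) ≅ A × C₂`, `|A| = n` even, abelian or not). [folklore] -/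
theorem fibreTwo_add_two_eq_card_block_of_cpl [IsCMField F] [IsGalois ℚ F] {A : Subgroup (GalT F)}
    (hA : ∀ P : GalT F, P ∈ A ↔ conjT * P ∉ A) (heven : Even (Module.finrank ℚ F / 2)) :
    fibreTwo (conjT : GalT F) conjT_mul_self + 2 = Fintype.card (Block (conjT : GalT F)) :=
  Census.Coinvariant.fibreTwo_add_two_eq_card_block_of_cpl conjT conjT_mul_self conjT_ne_one (fun P => FaceBasis.conjT_comm P) hA
    (by rw [FaceCensus.card_galT]; exact heven)

/-- **… by index**: a subgroup of index two of `GalT F` missing `conjT`, `n` even ⇒ `φ₂(F) + 2 = β(F)`. [folklore] -/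
theorem fibreTwo_add_two_eq_card_block_of_index_two [IsCMField F] [IsGalois ℚ F] {A : Subgroup (GalT F)} (h2 : A.index = 2)
    (hc : conjT ∉ A) (heven : Even (Module.finrank ℚ F / 2)) :
    fibreTwo (conjT : GalT F) conjT_mul_self + 2 = Fintype.card (Block (conjT : GalT F)) :=
  fibreTwo_add_two_eq_card_block_of_cpl (cpl_of_index_two h2 hc) heven

/-- **… with an `hgen` set of faces** (`conjT` complemented): `β(F) ≤ |𝒮| + 1 + δ(F)` and this parity floor IS the coinvariant floor
(`φ₂(F) = β(F) − 1 − δ(F) ≤ |𝒮|`). [folklore] -/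
theorem card_block_le_card_add_of_hgen_of_cpl [IsCMField F] [IsGalois ℚ F] {A : Subgroup (GalT F)}
    (hA : ∀ P : GalT F, P ∈ A ↔ conjT * P ∉ A) (T₀ : CMF (GalT F) conjT) (𝒮 : Finset (Face F)) (σ₀ : F →+* ℂ)
    (hgen : ∀ f : Face F, lefChar f.corner (fun _ => ({σ₀} : Finset (F →+* ℂ))) ∈ AddSubgroup.closure
      {a : Asym F | ∃ g ∈ (𝒮 : Set (Face F)), ∃ σ : F →+* ℂ, a = lefChar g.corner (fun _ => ({σ} : Finset (F →+* ℂ)))}) :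
    Fintype.card (Block (conjT : GalT F)) ≤ 𝒮.card + 1 + wdelta (conjT : GalT F) T₀ ∧
      fibreTwo (conjT : GalT F) conjT_mul_self + 1 + wdelta (conjT : GalT F) T₀ = Fintype.card (Block (conjT : GalT F)) := by
  have h1 := fibreTwo_le_card_of_hgen 𝒮 σ₀ hgen
  have h2 := fibreTwo_add_one_add_wdelta_eq_card_block_of_cpl hA T₀
  exact ⟨by omega, h2⟩

/-- **`n` even, `conjT` complemented, `hgen` set of faces: `β(F) ≤ |𝒮| + 2` is sharp for the coinvariant method.** [folklore] -/
theorem card_block_le_card_add_two_of_hgen_of_cpl [IsCMField F] [IsGalois ℚ F] {A : Subgroup (GalT F)}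
    (hA : ∀ P : GalT F, P ∈ A ↔ conjT * P ∉ A) (heven : Even (Module.finrank ℚ F / 2)) (𝒮 : Finset (Face F)) (σ₀ : F →+* ℂ)
    (hgen : ∀ f : Face F, lefChar f.corner (fun _ => ({σ₀} : Finset (F →+* ℂ))) ∈ AddSubgroup.closure
      {a : Asym F | ∃ g ∈ (𝒮 : Set (Face F)), ∃ σ : F →+* ℂ, a = lefChar g.corner (fun _ => ({σ} : Finset (F →+* ℂ)))}) :
    Fintype.card (Block (conjT : GalT F)) ≤ 𝒮.card + 2 ∧ fibreTwo (conjT : GalT F) conjT_mul_self ≤ 𝒮.card := by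
  have h1 := fibreTwo_le_card_of_hgen 𝒮 σ₀ hgen
  have h2 := fibreTwo_add_two_eq_card_block_of_cpl hA heven
  exact ⟨by omega, h1⟩

/-- **`2`-power degree, `conjT` complemented, `n` even: `β(F) − 2` abstract faces GENERATE the Hodge lattice of `F` mod `2` modulo
pairs** (gen 29 III: for `2`-groups `φ₂(F)` faces generate; here `φ₂(F) = β(F) − 2`; e.g. `Gal ≅ D₄ × C₂`: `25` faces, `Q₈ × C₂`: `19`,
`C₂⁴`: `28`, `ℤ/4 × ℤ/2 × C₂`: `22`, `ℤ/8 × C₂`: `18`). [folklore] -/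
theorem exists_faces_generate_of_cpl_of_finrank_eq_two_pow [IsCMField F] [IsGalois ℚ F] {A : Subgroup (GalT F)}
    (hA : ∀ P : GalT F, P ∈ A ↔ conjT * P ∉ A) {k : ℕ} (hk : Module.finrank ℚ F = 2 ^ k)
    (heven : Even (Module.finrank ℚ F / 2)) :
    ∃ S : Finset (CMF (GalT F) conjT →₀ ZMod 2), ↑S ⊆ faces2 (conjT : GalT F) conjT_mul_self ∧
      S.card + 2 = Fintype.card (Block (conjT : GalT F)) ∧
      hodge2 (conjT : GalT F) conjT_mul_self ≤ pair2 (conjT : GalT F) ⊔ Submodule.span (ZMod 2) (translates2 conjT S) := by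
  obtain ⟨S, hSF, hcard, hle⟩ := exists_faces_generate_of_finrank_eq_two_pow hk
  exact ⟨S, hSF, by rw [hcard, fibreTwo_add_two_eq_card_block_of_cpl hA heven], hle⟩

end Summit.HodgeConjecture.CorCM.FaceCoinvariant

end
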